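import Literature.NumberTheory.EllipticCurves.DeligneSerreWeightOneOfThm61
import Literature.NumberTheory.EllipticCurves.DeligneSerreWeightOneIrreducibleHolds
import Literature.NumberTheory.EllipticCurves.DeligneSerreProp27LevelDescentProofs
import HarnessLib

/-!
# Deligne–Serre 1974, Thm. 4.1 from Thm. 6.7 alone (Chebotarev and (2.7.2) discharged)

A *proofs* file (theorems only; no definition, no named fact, nothing restated; D-0026) recording
the state of the reduction of the named fact
`Literature.NumberTheory.EllipticCurves.ModularForms.DeligneSerre1974.thm41_exists`
(`NewformGaloisRepProofs`; Deligne–Serre, *Formes modulaires de poids 1*, Ann. Sci. ÉNS 7 (1974),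
Thm. 4.1, pp. 513–515: *"Il existe une représentation linéaire continue `ρ : G → GL₂(C)`, non
ramifiée en dehors de `N`, telle que `Tr(F_p) = a_p` et `det(F_p) = ε(p)` pour tout `p ∤ N`"*,
with §3 (a): the image is finite) now that two of the three deep inputs of its printed proof (§8)
are theorems of the tree:

* **(B) Chebotarev's density theorem over `ℚ`** (Lemme 8.3 and (6.12.1)):
  `Literature.NumberTheory.LFunctions.Chebotarev.dirichletDensity_eq_holds`
  (`ChebotarevDensityProofs`: Weber's ray-class count, regularity of ray-class `L`-series at
  `s = 1`, cyclotomic densities, Chebotarëv's 1926 crossing argument);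
* **(C) op. cit. Prop. 2.7 (2.7.2)** — `S_k(Γ₁(M))` is spanned by the forms all of whose diamond
  twists have integral `q`-expansion — for **every** level `M ≥ 1` and weight `k`:
  `Literature.NumberTheory.EllipticCurves.ModularForms.DeligneSerre1974_span_integralLattice1_holds`
  (`DeligneSerreProp27LevelDescentProofs`: the rank half of Eichler–Shimura for `Γ₁(M)`, `M ≥ 5`,
  by weight-`k` Manin symbols, Shimura's Hecke-stable real lattice (3.5.20) and Thm. 3.52, the
  `E₄`/`E₆` weight descent of Rem. 2.8, and level descent through `[α₅]_k` for `M ≤ 4`).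

What remains is exactly **(A) op. cit. Thm. 6.7 in weight one** (`thm67_weightOne`, the mod-`ℓ`
representations attached to a weight-one newform, p. 521), whose printed proof (6.8–6.13) is
proved in the tree (`NewformGaloisRepModLProofs`, `thm67_weightOne_of_thm61`) from **Deligne's
Thm. 6.1 at every finite place** (op. cit. p. 520, Deligne [5]; stated below as the hypothesis
`h61`, verbatim as in `thm67_weightOne_of_thm61`, not minted here):

* `thm41_exists_of_thm67` — `thm67_weightOne → thm41_exists` (no other hypothesis);
* `exists_complexGaloisRep_of_weight_one_of_thm67` — the full Deligne–Serre theorem (irreducible,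
  finite image, odd; `exists_complexGaloisRep_of_weight_one`) from `thm67_weightOne` alone;
* `thm67_weightOne_of_deligneThm61`, `thm41_exists_of_deligneThm61`,
  `exists_complexGaloisRep_of_weight_one_of_deligneThm61` — the same three statements from
  Thm. 6.1 alone.

So the discharge `thm41_exists_holds` is `thm41_exists_of_thm67 thm67_weightOne_holds` once
(A) is discharged, equivalently `thm41_exists_of_deligneThm61 ‹Thm. 6.1›`.

## References

* P. Deligne, J.-P. Serre, *Formes modulaires de poids 1*, Ann. Sci. ÉNS (4) 7 (1974), 507–530:
  Thm. 4.1 (pp. 513–515), Rem. 4.5, Prop. 2.7 and Rem. 2.8 (p. 512), Thm. 6.1 and Thm. 6.7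
  (pp. 520–521), 6.8–6.13, §8. doi:10.24033/asens.1277 [DeligneSerreASENS1974]
* P. Deligne, *Formes modulaires et représentations ℓ-adiques*, Sém. Bourbaki 355, LNM 179
  (1971) (op. cit. [5]).
-/

noncomputable section

open scoped MatrixGroups ModularForm NumberField Polynomial

open CongruenceSubgroup IsDedekindDomain Polynomial Rat.HeightOneSpectrum

namespace Literature.NumberTheory.EllipticCurves.ModularForms.DeligneSerre1974

variable {N : ℕ} [NeZero N]

/-- **Deligne–Serre 1974, Thm. 4.1 (existence, with §3 (a)) from Thm. 6.7 alone.** For every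
newform `f ∈ S_1(Γ₁(N))` there is a continuous representation `Gal(ℚ̄/ℚ) → GL₂(ℂ)` with finite
image attached to `f` away from `N` (`thm41_exists`), granted op. cit. Thm. 6.7 in weight one
(`thm67_weightOne`). This is `thm41_exists_of_leaves` (§8.2–8.6 with Prop. 5.1, 5.5, 7.2, 2.7,
Lemme 3.2 and the lift of 8.6, all proved) with its Chebotarev hypothesis (Lemme 8.3) discharged
by `LFunctions.Chebotarev.dirichletDensity_eq_holds` and its hypothesis (2.7.2) (all levels and
weights) discharged by `DeligneSerre1974_span_integralLattice1_holds`.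
[cite: DeligneSerreASENS1974, Thm. 4.1 and §8.2–8.6] -/
theorem thm41_exists_of_thm67 (h67 : thm67_weightOne (N := N)) : thm41_exists (N := N) :=
  thm41_exists_of_leaves h67 LFunctions.Chebotarev.dirichletDensity_eq_holds
    fun M _ k ↦ DeligneSerre1974_span_integralLattice1_holds M k

/-- **The Deligne–Serre theorem (Thm. 4.1 with §3 (a) and Rem. 4.5) from Thm. 6.7 alone.** For
every newform `f ∈ S_1(Γ₁(N))` there is a continuous `ρ_f : Gal(ℚ̄/ℚ) → GL₂(ℂ)` attached to `f`
away from `N`, irreducible, with finite image and odd (`exists_complexGaloisRep_of_weight_one`),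
granted op. cit. Thm. 6.7 in weight one (`thm67_weightOne`): `thm41_exists_of_thm67` followed by
`exists_complexGaloisRep_of_weight_one_of_thm41_exists` (irreducibility §8.7 and oddness
Rem. 4.5 are theorems of the tree). [cite: DeligneSerreASENS1974, Thm. 4.1 and Rem. 4.5] -/
theorem exists_complexGaloisRep_of_weight_one_of_thm67 (h67 : thm67_weightOne (N := N)) :
    exists_complexGaloisRep_of_weight_one (N := N) :=
  exists_complexGaloisRep_of_weight_one_of_thm41_exists (thm41_exists_of_thm67 h67)

/-- **Deligne–Serre 1974, Thm. 6.7 in weight one from Deligne's Thm. 6.1 alone.** For a newform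
`f ∈ S_1(Γ₁(N))`, a prime `ℓ` and `ι : 𝓞_f → 𝔽_ℓ` there is a semisimple
`ρ : Gal(ℚ̄/ℚ) → GL₂(𝔽_ℓ)` unramified outside `N ℓ` with
`det(X - ρ(F_p)) = X² - ι(a_p) X + ι(ε(p))` for `p ∤ N ℓ` (`thm67_weightOne`), granted Thm. 6.1
as printed (op. cit. p. 520, Deligne [5]): for `g ≠ 0` of type `(k, χ)` on `Γ₀(M)`, `k ≥ 2`, an
eigenvector of the `T_p` (`p ∤ M`) with eigenvalues `a_p`, `K` a number field containing the
`a_p` and the `χ(p)`, and **every** finite place `v` of `K`, a continuous semisimple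
`ρ_v : Gal(ℚ̄/ℚ) → GL₂(K_v)`, unramified at `p ∤ M`, `p ∉ v`, with
`det(X - ρ_v(F_p)) = X² - a_p X + χ(p) p^{k-1}` (6.1.1). This is
`thm67_weightOne_of_thm61_of_span` (6.8–6.13 proved, Lemme 6.13 by
`Literature.RepresentationTheory.Semisimple.exists_descent_fin_two`) with Chebotarev ((6.12.1))
and (2.7.2) in weight one discharged.
[cite: DeligneSerreASENS1974, Thm. 6.7 with Thm. 6.1 and 6.8–6.13] -/
theorem thm67_weightOne_of_deligneThm61
    (h61 : ∀ (M : ℕ) [NeZero M] (k : ℤ), 2 ≤ k →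
      ∀ (g : CuspForm (Gamma1 M) k) (χ : DirichletCharacter ℂ M),
        g ∈ nebentypusSubspace M k χ → g ≠ 0 →
      ∀ (K : Type) [Field K] [NumberField K] (e : K →+* ℂ) (a : ℕ → K) (c : ZMod M → K),
        (∀ d, e (c d) = χ d) →
        (∀ (p : ℕ) (hp : p.Prime), ¬ p ∣ M →
          (haveI : NeZero p := ⟨hp.ne_zero⟩; heckeT (Gamma1 M) k p g) = e (a p) • g) →
      ∀ v : HeightOneSpectrum (𝓞 K),
        ∃ ρ : GaloisRepresentations.FramedGaloisRep ℚ (v.adicCompletion K) 2,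
          ρ.toGaloisRep.IsSemisimple ∧
          ∀ w : HeightOneSpectrum (𝓞 ℚ), ¬ ((primesEquiv w : Nat.Primes) : ℕ) ∣ M →
            (((primesEquiv w : Nat.Primes) : ℕ) : 𝓞 K) ∉ v.asIdeal →
            ρ.IsUnramifiedAt w ∧
            ρ.HasFrobCharpolyAt w
              ((X ^ 2 - C (a ((primesEquiv w : Nat.Primes) : ℕ)) * X +
                C (c ((primesEquiv w : Nat.Primes) : ℕ) *
                  (((primesEquiv w : Nat.Primes) : ℕ) : K) ^ (k - 1))).map
                (algebraMap K (v.adicCompletion K)))) :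
    thm67_weightOne (N := N) :=
  thm67_weightOne_of_thm61_of_span h61 LFunctions.Chebotarev.dirichletDensity_eq_holds
    (DeligneSerre1974_span_integralLattice1_holds N 1)

/-- **Deligne–Serre 1974, Thm. 4.1 (existence, with §3 (a)) from Deligne's Thm. 6.1 alone.** For
every newform `f ∈ S_1(Γ₁(N))` there is a continuous representation `Gal(ℚ̄/ℚ) → GL₂(ℂ)` with
finite image attached to `f` away from `N` (`thm41_exists`), granted only Thm. 6.1 as printed
(Deligne's `λ`-adic representations attached to eigenforms of weight `k ≥ 2` at **every** finite
place; hypothesis `h61` as in `thm67_weightOne_of_deligneThm61`). Everything else in the printed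
proof — Thm. 6.7 from 6.1 (6.8–6.13), §8 with Prop. 5.1, 5.5, 7.2, Prop. 2.7/(2.7.2), Lemme 3.2,
Lemme 8.3 (Chebotarev) and the lift of 8.6 — is a theorem of the tree.
[cite: DeligneSerreASENS1974, Thm. 4.1; proof §8 with Thm. 6.1 and Thm. 6.7] -/
theorem thm41_exists_of_deligneThm61
    (h61 : ∀ (M : ℕ) [NeZero M] (k : ℤ), 2 ≤ k →
      ∀ (g : CuspForm (Gamma1 M) k) (χ : DirichletCharacter ℂ M),
        g ∈ nebentypusSubspace M k χ → g ≠ 0 →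
      ∀ (K : Type) [Field K] [NumberField K] (e : K →+* ℂ) (a : ℕ → K) (c : ZMod M → K),
        (∀ d, e (c d) = χ d) →
        (∀ (p : ℕ) (hp : p.Prime), ¬ p ∣ M →
          (haveI : NeZero p := ⟨hp.ne_zero⟩; heckeT (Gamma1 M) k p g) = e (a p) • g) →
      ∀ v : HeightOneSpectrum (𝓞 K),
        ∃ ρ : GaloisRepresentations.FramedGaloisRep ℚ (v.adicCompletion K) 2,
          ρ.toGaloisRep.IsSemisimple ∧
          ∀ w : HeightOneSpectrum (𝓞 ℚ), ¬ ((primesEquiv w : Nat.Primes) : ℕ) ∣ M →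
            (((primesEquiv w : Nat.Primes) : ℕ) : 𝓞 K) ∉ v.asIdeal →
            ρ.IsUnramifiedAt w ∧
            ρ.HasFrobCharpolyAt w
              ((X ^ 2 - C (a ((primesEquiv w : Nat.Primes) : ℕ)) * X +
                C (c ((primesEquiv w : Nat.Primes) : ℕ) *
                  (((primesEquiv w : Nat.Primes) : ℕ) : K) ^ (k - 1))).map
                (algebraMap K (v.adicCompletion K)))) :
    thm41_exists (N := N) :=
  thm41_exists_of_thm67 (thm67_weightOne_of_deligneThm61 h61)

/-- **The Deligne–Serre theorem (Thm. 4.1 with §3 (a) and Rem. 4.5) from Deligne's Thm. 6.1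
alone**: for every newform `f ∈ S_1(Γ₁(N))` a continuous `ρ_f : Gal(ℚ̄/ℚ) → GL₂(ℂ)` attached to
`f` away from `N`, irreducible, with finite image and odd (`exists_complexGaloisRep_of_weight_one`),
granted only Thm. 6.1 as printed (hypothesis `h61` as in `thm67_weightOne_of_deligneThm61`).
[cite: DeligneSerreASENS1974, Thm. 4.1, Rem. 4.5 and Thm. 6.1] -/
theorem exists_complexGaloisRep_of_weight_one_of_deligneThm61
    (h61 : ∀ (M : ℕ) [NeZero M] (k : ℤ), 2 ≤ k →
      ∀ (g : CuspForm (Gamma1 M) k) (χ : DirichletCharacter ℂ M),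
        g ∈ nebentypusSubspace M k χ → g ≠ 0 →
      ∀ (K : Type) [Field K] [NumberField K] (e : K →+* ℂ) (a : ℕ → K) (c : ZMod M → K),
        (∀ d, e (c d) = χ d) →
        (∀ (p : ℕ) (hp : p.Prime), ¬ p ∣ M →
          (haveI : NeZero p := ⟨hp.ne_zero⟩; heckeT (Gamma1 M) k p g) = e (a p) • g) →
      ∀ v : HeightOneSpectrum (𝓞 K),
        ∃ ρ : GaloisRepresentations.FramedGaloisRep ℚ (v.adicCompletion K) 2,
          ρ.toGaloisRep.IsSemisimple ∧
          ∀ w : HeightOneSpectrum (𝓞 ℚ), ¬ ((primesEquiv w : Nat.Primes) : ℕ) ∣ M →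
            (((primesEquiv w : Nat.Primes) : ℕ) : 𝓞 K) ∉ v.asIdeal →
            ρ.IsUnramifiedAt w ∧
            ρ.HasFrobCharpolyAt w
              ((X ^ 2 - C (a ((primesEquiv w : Nat.Primes) : ℕ)) * X +
                C (c ((primesEquiv w : Nat.Primes) : ℕ) *
                  (((primesEquiv w : Nat.Primes) : ℕ) : K) ^ (k - 1))).map
                (algebraMap K (v.adicCompletion K)))) :
    exists_complexGaloisRep_of_weight_one (N := N) :=
  exists_complexGaloisRep_of_weight_one_of_thm41_exists (thm41_exists_of_deligneThm61 h61)

end Literature.NumberTheory.EllipticCurves.ModularForms.DeligneSerre1974
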